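import Summits.CriticalPhenomena.PercolationContinuityZ3.Theorems.PercNearOneGluingNoHeavyLowerTailSahiCoordinateTwoThirds
import Summits.CriticalPhenomena.PercolationContinuityZ3.Theorems.SahiMasterFamilyZeroFamilies
import Mathlib.Tactic.Linarith
import Mathlib.Tactic.Ring
import HarnessLib

/-!
# `NoHeavyLowerTail` (crux stmt-CriticalPhenomena-4575), master family at ORDER FIVE: the one-coordinate RUNG PIECES of `E_5`, the local step,
# and the typed conjecture (RUNG-5) "`5B₁ ≥ B₀`, `B₂ ≥ 0`, `B₃ ≥ 0`, `5B₄ ≥ B₅` at every coordinate" with its reduction to Sahi's `C_5` on product measures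

Support file (seat `prim-masterthm-p1`, gen 7; `--supports stmt-CriticalPhenomena-4575`); four definitions (`rungPiece₁..₄`) and ONE `@[conjecture]` definition (`FiveRung`,
an obligation of THIS programme — census-backed, NOT a published fact), no sorry.  The order-4 twin is `…SahiCoordinateQuarticRung` (p318945); memo
`run/shared/lean/prim/prim-masterthm/FROM-prim-masterthm-p1-g7-CLASS-TANGENT.md` §6 (the RUNG-k programme: `kB₁ ≥ B₀`, `kB_{k−1} ≥ B_k`, `B_j ≥ 0` for `2 ≤ j ≤ k−2`
at one coordinate + sections `≥ 0` ⟹ `E_k ≥ p_e^{k−1}E_k¹ + (1−p_e)^{k−1}E_k⁰ ≥ 0`; RUNG-2 is a theorem, RUNG-3 = bnk-2's `SahiTwoLevelMinus ∧ Plus`, RUNG-4 = `FourRung`).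

For five increasing events `U_0..U_4`, a product weight and a coordinate `e`, `s ↦ E_5(μ_{p[e↦s]}; 1_U)` is the QUINTIC `Q = sahiEP (secPoly p e) 5 (1_U) = Σ_{i≤5} c_i s^i`, and
  `Q(s) = s⁴Q(1) + (1−s)⁴Q(0) + s(1−s)·[(1−s)³r₁ + s(1−s)²r₂ + s²(1−s)r₃ + s³r₄]`,
  `r₁ = 4c₀ + c₁ = 5B₁ − B₀`, `r₂ = 10c₀ + 4c₁ + c₂ = 10B₂`, `r₃ = 10c₀ + 6c₁ + 3c₂ + c₃ = 10B₃`, `r₄ = 4c₀ + 3c₁ + 2c₂ + c₃ − c₅ = 5B₄ − B₅`  (`quintic_rung_decomp`).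
* `sahiE_five_decomp_coord`, **`sahiE_five_nonneg_of_rungAt`** (the local step), `FiveRung` (typed), **`masterFamilyNonneg_five_of_fiveRung : FiveRung → MasterFamilyNonneg 5`**.
CENSUS (this seat, exact integer comb arithmetic, engine code-g7/census5/quint.c, validated against an exact python evaluation at n = 2): all 5-tuples of increasing events on `≤ 3`
coordinates (88 550 mod symmetry) and 3·10⁶ structured-random 5-tuples on 4 coordinates (kit j151691): 0 violations of RUNG-5, of the λ = 1 top law `5B₄ ≥ 4B₅` and of comb positivity.
HONEST FRAMING: typed conjecture + consequence; evidence is thinner than for k = 3, 4 (no exhaustive 4-coordinate run); Sahi's `C_5` and (RUNG-5) remain OPEN.  Axioms standard. [this work]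
-/

noncomputable section

open scoped Classical

namespace Summit.CriticalPhenomena.PercolationContinuityZ3.Theorems

namespace SahiCoordinateQuinticRung

open Finset Function Polynomial
open Literature.Combinatorics.Sahi2008
open Literature.Probability.Percolation (DeterminedBy determinedBy_iff)
open Literature.Probability.Percolation.DecisionTree (ind ind_of_mem ind_of_not_mem ind_nonneg)

/-! ### 1. The quartic decomposition -/

/-- **A quintic through its endpoint values and four rung pieces** (ring identity for `deg Q ≤ 5`). [this work] -/
theorem quintic_rung_decomp (Q : ℝ[X]) (hQ : Q.natDegree ≤ 5) (s : ℝ) :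
    Q.eval s = s ^ 4 * Q.eval 1 + (1 - s) ^ 4 * Q.eval 0 +
      s * (1 - s) * ((1 - s) ^ 3 * (4 * Q.coeff 0 + Q.coeff 1) + s * (1 - s) ^ 2 * (10 * Q.coeff 0 + 4 * Q.coeff 1 + Q.coeff 2)
        + s ^ 2 * (1 - s) * (10 * Q.coeff 0 + 6 * Q.coeff 1 + 3 * Q.coeff 2 + Q.coeff 3)
        + s ^ 3 * (4 * Q.coeff 0 + 3 * Q.coeff 1 + 2 * Q.coeff 2 + Q.coeff 3 - Q.coeff 5)) := by
  have hrep : ∀ x : ℝ, Q.eval x = Q.coeff 0 + Q.coeff 1 * x + Q.coeff 2 * x ^ 2 + Q.coeff 3 * x ^ 3 + Q.coeff 4 * x ^ 4 + Q.coeff 5 * x ^ 5 := by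
    intro x
    conv_lhs => rw [Q.as_sum_range_C_mul_X_pow' (show Q.natDegree < 6 by omega)]
    simp only [Finset.sum_range_succ, Finset.sum_range_zero, eval_add, eval_mul, eval_C, eval_pow, eval_X, zero_add]
    ring
  rw [hrep s, hrep 0, hrep 1]
  ring

variable {ι : Type} [Fintype ι]

/-- The fibre quintic of a quintuple along `e`. [this work] -/
def fibreQ (p : ι → unitInterval) (e : ι) (U : Fin 5 → Set (Set ι)) : ℝ[X] := sahiEP (secPoly p e) 5 (fun j => ind (U j))

/-- **First rung piece** `r₁ = 4c₀ + c₁ = 5B₁ − B₀`. [this work] -/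
def rungPiece₁ (p : ι → unitInterval) (e : ι) (U : Fin 5 → Set (Set ι)) : ℝ := 4 * (fibreQ p e U).coeff 0 + (fibreQ p e U).coeff 1

/-- **Second rung piece** `r₂ = 10c₀ + 4c₁ + c₂ = 10B₂`. [this work] -/
def rungPiece₂ (p : ι → unitInterval) (e : ι) (U : Fin 5 → Set (Set ι)) : ℝ :=
  10 * (fibreQ p e U).coeff 0 + 4 * (fibreQ p e U).coeff 1 + (fibreQ p e U).coeff 2

/-- **Third rung piece** `r₃ = 10c₀ + 6c₁ + 3c₂ + c₃ = 10B₃`. [this work] -/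
def rungPiece₃ (p : ι → unitInterval) (e : ι) (U : Fin 5 → Set (Set ι)) : ℝ :=
  10 * (fibreQ p e U).coeff 0 + 6 * (fibreQ p e U).coeff 1 + 3 * (fibreQ p e U).coeff 2 + (fibreQ p e U).coeff 3

/-- **Fourth rung piece** `r₄ = 4c₀ + 3c₁ + 2c₂ + c₃ − c₅ = 5B₄ − B₅`. [this work] -/
def rungPiece₄ (p : ι → unitInterval) (e : ι) (U : Fin 5 → Set (Set ι)) : ℝ :=
  4 * (fibreQ p e U).coeff 0 + 3 * (fibreQ p e U).coeff 1 + 2 * (fibreQ p e U).coeff 2 + (fibreQ p e U).coeff 3 - (fibreQ p e U).coeff 5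

/-- The fibre quintic at the boundary `s = b ∈ {0,1}` is `E_5` of the `b`-sections under the ORIGINAL measure. [this work] -/
theorem eval_fibre_boolParam_five (p : ι → unitInterval) (e : ι) (b : Bool) (U : Fin 5 → Set (Set ι)) :
    (fibreQ p e U).eval ((boolParam b : unitInterval) : ℝ) =
      sahiE (bernoulliWeight p) 5 (fun j => ind (secAt e b (U j))) := by
  rw [fibreQ, ← sahiE_update_eq_eval, sahiE_update_boolParam_eq_secAt, sahiE_secAt_update_eq p e b (boolParam b) (p e), update_eq_self]

/-- **ONE-COORDINATE DECOMPOSITION of `E_5` under a product measure**: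
`E_5(μ_p; U) = p_e⁴·E_5(U^{e←1}) + (1−p_e)⁴·E_5(U^{e←0}) + p_e(1−p_e)·[(1−p_e)³r₁ + p_e(1−p_e)²r₂ + p_e²(1−p_e)r₃ + p_e³r₄]`. [this work] -/
theorem sahiE_five_decomp_coord (p : ι → unitInterval) (e : ι) (U : Fin 5 → Set (Set ι)) :
    sahiE (bernoulliWeight p) 5 (fun j => ind (U j)) =
      (p e : ℝ) ^ 4 * sahiE (bernoulliWeight p) 5 (fun j => ind (secAt e true (U j)))
      + (1 - (p e : ℝ)) ^ 4 * sahiE (bernoulliWeight p) 5 (fun j => ind (secAt e false (U j)))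
      + (p e : ℝ) * (1 - (p e : ℝ)) * ((1 - (p e : ℝ)) ^ 3 * rungPiece₁ p e U + (p e : ℝ) * (1 - (p e : ℝ)) ^ 2 * rungPiece₂ p e U
          + (p e : ℝ) ^ 2 * (1 - (p e : ℝ)) * rungPiece₃ p e U + (p e : ℝ) ^ 3 * rungPiece₄ p e U) := by
  have h0 := eval_fibre_boolParam_five p e false U
  have h1 := eval_fibre_boolParam_five p e true U
  have hb0 : ((boolParam false : unitInterval) : ℝ) = 0 := by simp [boolParam]
  have hb1 : ((boolParam true : unitInterval) : ℝ) = 1 := by simp [boolParam]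
  rw [hb0] at h0
  rw [hb1] at h1
  have hdeg : (fibreQ p e U).natDegree ≤ 5 := natDegree_sahiEP_le (secPoly p e) (natDegree_secPoly_le p e) 5 _
  have hmain := quintic_rung_decomp _ hdeg (p e : ℝ)
  rw [h0, h1] at hmain
  have hev : (fibreQ p e U).eval (p e : ℝ) = sahiE (bernoulliWeight p) 5 (fun j => ind (U j)) := by
    rw [fibreQ, ← sahiE_update_eq_eval, update_eq_self]
  rw [hev] at hmain
  rw [hmain, rungPiece₁, rungPiece₂, rungPiece₃, rungPiece₄]

/-! ### 2. The local step -/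

/-- **THE LOCAL STEP (λ = 4 rung).**  If the four rung pieces at `e` are `≥ 0` and both `e`-sections have `E_5 ≥ 0`, then
`E_5(μ_p; U) ≥ p_e⁴·E_5(U^{e←1}) + (1−p_e)⁴·E_5(U^{e←0}) ≥ 0`. [this work] -/
theorem sahiE_five_nonneg_of_rungAt (p : ι → unitInterval) (e : ι) (U : Fin 5 → Set (Set ι))
    (h1 : 0 ≤ rungPiece₁ p e U) (h2 : 0 ≤ rungPiece₂ p e U) (h3 : 0 ≤ rungPiece₃ p e U) (h4 : 0 ≤ rungPiece₄ p e U)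
    (hsec0 : 0 ≤ sahiE (bernoulliWeight p) 5 (fun j => ind (secAt e false (U j))))
    (hsec1 : 0 ≤ sahiE (bernoulliWeight p) 5 (fun j => ind (secAt e true (U j)))) :
    0 ≤ sahiE (bernoulliWeight p) 5 (fun j => ind (U j)) := by
  rw [sahiE_five_decomp_coord p e U]
  have ht0 : 0 ≤ (p e : ℝ) := (p e).2.1
  have ht1' : (p e : ℝ) ≤ 1 := (p e).2.2
  have ht1 : 0 ≤ 1 - (p e : ℝ) := by linarith
  have hmix : 0 ≤ (1 - (p e : ℝ)) ^ 3 * rungPiece₁ p e U + (p e : ℝ) * (1 - (p e : ℝ)) ^ 2 * rungPiece₂ p e U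
      + (p e : ℝ) ^ 2 * (1 - (p e : ℝ)) * rungPiece₃ p e U + (p e : ℝ) ^ 3 * rungPiece₄ p e U :=
    add_nonneg (add_nonneg (add_nonneg (mul_nonneg (pow_nonneg ht1 3) h1) (mul_nonneg (mul_nonneg ht0 (pow_nonneg ht1 2)) h2))
      (mul_nonneg (mul_nonneg (pow_nonneg ht0 2) ht1) h3)) (mul_nonneg (pow_nonneg ht0 3) h4)
  exact add_nonneg (add_nonneg (mul_nonneg (pow_nonneg ht0 4) hsec1) (mul_nonneg (pow_nonneg ht1 4) hsec0))
    (mul_nonneg (mul_nonneg ht0 ht1) hmix)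

/-! ### 3. The conjecture, typed, and its reduction to `C_5` -/

/-- **CONJECTURE (RUNG-5)**, an obligation of this programme (NOT a published fact): for every finite cube, every product weight `p`, every five increasing
events `U_0..U_4` and EVERY coordinate `e`, the four one-coordinate rung pieces of `E_5` are nonnegative: `5B₁ ≥ B₀`, `B₂ ≥ 0`, `B₃ ≥ 0`, `5B₄ ≥ B₅`.
Census: exhaustive on `≤ 3` coordinates (88 550 5-tuples) and 3·10⁶ structured-random 5-tuples on 4 coordinates (kit j151691), 0 violations (memo §6).  Implies Sahi's
`C_5` for product measures (`masterFamilyNonneg_five_of_fiveRung`). [cite: Sahi2008, Conj. 5 (p. 212); LiebSahi2021, Conj. 1.1] [status: open] -/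
@[conjecture] def FiveRung : Prop :=
  ∀ (ι : Type) [Fintype ι] (p : ι → unitInterval) (U : Fin 5 → Set (Set ι)), (∀ j, IsUpperSet (U j)) →
    ∀ e : ι, 0 ≤ rungPiece₁ p e U ∧ 0 ≤ rungPiece₂ p e U ∧ 0 ≤ rungPiece₃ p e U ∧ 0 ≤ rungPiece₄ p e U

/-- **(RUNG-5) ⟹ Sahi's `C_5` for product measures** (induction on the size of a determining set). [this work] -/
theorem masterFamilyNonneg_five_of_fiveRung (hR : FiveRung) : MasterFamilyNonneg 5 := by
  intro κ _ p U hU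
  suffices key : ∀ (m : ℕ) (V : Fin 5 → Set (Set κ)) (S : Finset κ), S.card = m → (∀ j, IsUpperSet (V j)) →
      (∀ j, DeterminedBy (V j) (↑S : Set κ)) → 0 ≤ sahiE (bernoulliWeight p) 5 (fun j => ind (V j)) from
    key _ U Finset.univ rfl hU fun j => (determinedBy_iff _ _).2 fun ω ω' h => by
      rw [Finset.coe_univ, Set.inter_univ, Set.inter_univ] at h; rw [h]
  intro m
  induction m using Nat.strong_induction_on with
  | _ m ih =>
  intro V S hS hV hVS
  rcases S.eq_empty_or_nonempty with hSe | hSne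
  · subst hSe
    exact (masterFamilyEqIff_mpr 5 κ p V
      (suppZeroFlag_of_pairwise_disjoint 3 V (fun _ => ∅) (fun _ _ _ => disjoint_bot_left) hVS)).ge
  · obtain ⟨e, heS⟩ := hSne
    have hlt : (S.erase e).card < m := by rw [← hS]; exact Finset.card_erase_lt_of_mem heS
    have E0 := ih _ hlt (fun j => secAt e false (V j)) (S.erase e) rfl (fun j => isUpperSet_secAt e false (hV j))
      (fun j => determinedBy_secAt e false (hVS j))
    have E1 := ih _ hlt (fun j => secAt e true (V j)) (S.erase e) rfl (fun j => isUpperSet_secAt e true (hV j))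
      (fun j => determinedBy_secAt e true (hVS j))
    obtain ⟨h1, h2, h3, h4⟩ := hR κ p V hV e
    exact sahiE_five_nonneg_of_rungAt p e V h1 h2 h3 h4 E0 E1

end SahiCoordinateQuinticRung

end Summit.CriticalPhenomena.PercolationContinuityZ3.Theorems
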